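import Summits.BirchSwinnertonDyer.BirchSwinnertonDyer.Theorems.ResidualThetaTransportAtTwoThetaLayerLambdaCongruenceAtTwoMuW1OfUndepleted
import Summits.BirchSwinnertonDyer.BirchSwinnertonDyer.Theorems.ResidualThetaTransportAtTwoThetaLayerLambdaCongruenceAtTwoUndepletedMaxOfCuspSpan
import HarnessLib

/-!
# Crux `ThetaLayerLambdaCongruenceAtTwo` (stmt-BirchSwinnertonDyer-20688, route ResidualThetaTransportAtTwo), line `birth`:
# THE CRUX BY NAME from the named Literature facts + the route's curve-free spanning predicate `CuspSpanEvenAtTwo` (odd levels)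
# (width seat bsd-wall-rtt-p3-w3 g4; `--supports stmt-BirchSwinnertonDyer-20688 --as helper`; closes nothing)

HONEST FRAMING. THEOREMS ONLY; every research / Literature input is an explicit hypothesis; nothing about any curve or form is
asserted; BSD is not proved by this.  Composes `…MuW1OfUndepleted` (p607312: (PR₂) ⟹ (μ-W₁) ⟹ crux, given the facts) with
`…UndepletedMaxOfCuspSpan` (p609376: `CuspSpanEvenAtTwo N_W` ⟹ (PR₂) at `(W,f)`):

* `thetaLayerLambdaCongruenceAtTwo_of_facts_cuspSpan_deligne` — THE CRUX ⟸ six plus-line facts + Deligne + `∀ odd N, CuspSpanEvenAtTwo N`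
  (the binder of crux Kμ⁺'s `SignedMuAtTwo.flatMuZeroAtTwo_of_forall_cuspSpanEvenAtTwo`): Kan⁺ (stmt-BirchSwinnertonDyer-20688) and
  Kμ⁺'s analytic half (stmt-BirchSwinnertonDyer-21437) rest on ONE common conjecture-grade, curve-free, finite-per-level node
  (`…CuspSpanDefs`, p595076) plus printed facts; `…_of_facts_cuspSpanHabitat_deligne` — the same with the predicate only at the
  habitat⁺ conductors.
* `flatAtTwo_of_undepletedMax` — (PR₂) at `(W,f)` ⟹ `2 ∤ L⁻` for every Pollack pair of `f` at `2` (Kμ⁺'s FLAT statement per curve):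
  the maximum is `≥ ‖[γ∞]⁺_f‖₂ = ‖1/2‖₂ = 2` (`exists_ratPlusSymbol_maninCusp_eq_one_half`), so rtt-p4's door
  `flatAtTwo_of_two_le_norm_ratPlusSymbol` applies — the per-curve statement (PR₂) (skeleton v11's registered research stub) is a
  common node of both cruxes as well, weaker than `CuspSpanEvenAtTwo N_W`.
* `undepletedMax_layerZero_of_norm_ratPlusSymbol_zero_eq_one` — a per-curve CERTIFICATE: if `[0]⁺_f = L(f,1)/Ω⁺_f` is a `2`-adic unit
  then (PR₂) holds at layer `n₁ = 0` (cusp `1/4`; `[0]⁺ = −2[1/4]⁺` from `T₂ = 0`) — Kurihara's unit-L-value case, no conjecture.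

References: [Pollack2003] Conj. 6.3; [PollackWeston2011MT] Rem. 4.2, Thm. 4.1; [GreenbergVatsal2000] §1 (10), §2 Prop. (2.4).
-/

noncomputable section

-- justification: the `Summit.BirchSwinnertonDyer.BirchSwinnertonDyer.…` path repeats a component (route-file convention)
set_option linter.dupNamespace false

open Literature.NumberTheory.EllipticCurves Literature.NumberTheory.EllipticCurves.ModularForms

namespace Summit.BirchSwinnertonDyer.BirchSwinnertonDyer.Theorems.ThetaLayerLambdaCongruenceAtTwo

/-- **THE CRUX `ThetaLayerLambdaCongruenceAtTwo` BY NAME from SIX NAMED FACTS + `CuspSpanEvenAtTwo` (odd levels) + DELIGNE.**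
Chain: `CuspSpanEvenAtTwo N` for every odd `N` ⟹ (PR₂) on the habitat⁺ (`undepletedMax_of_forall_cuspSpanEvenAtTwo`, §3)
⟹ (μ-W₁) for every admissible `S₀` (`curveDepletedSymbolMaxAtTwoPowerCusp_of_undepleted`, `…MuW1OfUndepleted`) ⟹ the crux
(w3 g3's `thetaLayerLambdaCongruenceAtTwo_of_facts_curveMax_deligne`, `…StarCruxGlue`).  So the research input of crux Kan⁺
(stmt-BirchSwinnertonDyer-20688) is the SAME curve-free, `f`-free, finite-per-level `@[conjecture]` predicate
`SignedMuAtTwo.CuspSpanEvenAtTwo` (p595076) on which crux Kμ⁺'s analytic half rests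
(`SignedMuAtTwo.flatMuZeroAtTwo_of_forall_cuspSpanEvenAtTwo`, `…signedMuAnalyticAtTwoPlus_of_abbesUllmo_of_forall_cuspSpanEvenAtTwo`);
everything else is printed: `eichlerShimura_depletedOptimalQuotient_periodLattice_of_dvd`, `WeierstrassCurve.isIsogenous_iff_frobeniusTrace_eq`
(Faltings), `mazurKenku_exists_cyclic_isogeny`, `heckeSelfDual_torsionBy_J0`, `buzzard2000_multiplicityOne_gamma0`,
`serre1972_supersingular_decompositionSubgroup_image`, `Deligne1974_heckeT_eigenvalue_norm_le`.  BSD is not proved by this.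
[cite: Pollack2003, Conj. 6.3] [cite: PollackWeston2011MT, Rem. 4.2.1 and Thm. 4.1] [cite: GreenbergVatsal2000, §1 (10), §2 Prop. (2.4)] -/
theorem thetaLayerLambdaCongruenceAtTwo_of_facts_cuspSpan_deligne
    (hES : eichlerShimura_depletedOptimalQuotient_periodLattice_of_dvd)
    (hF : WeierstrassCurve.isIsogenous_iff_frobeniusTrace_eq) (hMK : mazurKenku_exists_cyclic_isogeny)
    (hSD : heckeSelfDual_torsionBy_J0) (hBz : buzzard2000_multiplicityOne_gamma0)
    (hSe : serre1972_supersingular_decompositionSubgroup_image)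
    (hG : ∀ (N : ℕ) [NeZero N], ¬ 2 ∣ N → SignedMuAtTwo.CuspSpanEvenAtTwo N)
    (hD : Deligne1974_heckeT_eigenvalue_norm_le) :
    Summit.BirchSwinnertonDyer.BirchSwinnertonDyer.Theses.ResidualThetaTransportAtTwo.ThetaLayerLambdaCongruenceAtTwo :=
  thetaLayerLambdaCongruenceAtTwo_of_facts_undepletedMax_deligne hES hF hMK hSD hBz hSe
    (undepletedMax_of_forall_cuspSpanEvenAtTwo hG) hD

/-- **THE CRUX from the named facts + `CuspSpanEvenAtTwo` at the HABITAT⁺ CONDUCTORS only** (the weakest curve-free form: the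
predicate is needed only at the levels `N_W` of habitat⁺ curves — 147 conductors in the census, all kit-verified by rtt-p4).
BSD is not proved by this. [cite: Pollack2003, Conj. 6.3] -/
theorem thetaLayerLambdaCongruenceAtTwo_of_facts_cuspSpanHabitat_deligne
    (hES : eichlerShimura_depletedOptimalQuotient_periodLattice_of_dvd)
    (hF : WeierstrassCurve.isIsogenous_iff_frobeniusTrace_eq) (hMK : mazurKenku_exists_cyclic_isogeny)
    (hSD : heckeSelfDual_torsionBy_J0) (hBz : buzzard2000_multiplicityOne_gamma0)
    (hSe : serre1972_supersingular_decompositionSubgroup_image)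
    (hG : ∀ (W : WeierstrassCurve ℚ) [W.IsElliptic] [W.IsGloballyMinimal], ¬ W.HasCM → W.analyticRank = 0 →
      Literature.NumberTheory.EllipticCurves.Rank1Residual.GoodSS W 2 → W.frobeniusTrace 2 = 0 → W.Δ < 0 →
      ∀ [NeZero (W.conductorNorm ℤ)], SignedMuAtTwo.CuspSpanEvenAtTwo (W.conductorNorm ℤ))
    (hD : Deligne1974_heckeT_eigenvalue_norm_le) :
    Summit.BirchSwinnertonDyer.BirchSwinnertonDyer.Theses.ResidualThetaTransportAtTwo.ThetaLayerLambdaCongruenceAtTwo :=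
  thetaLayerLambdaCongruenceAtTwo_of_facts_undepletedMax_deligne hES hF hMK hSD hBz hSe
    (fun W _ _ hcm hr hss ha hΔ _ _ hf ↦ undepletedMax_of_cuspSpanEvenAtTwo hf hss ha (hG W hcm hr hss ha hΔ)) hD

/-! ## (PR₂) also gives crux Kμ⁺'s FLAT statement: (PR₂) is a per-curve node serving BOTH cruxes -/

section Flat

open scoped MatrixGroups
open CongruenceSubgroup Summit.BirchSwinnertonDyer.Rank1Residual.Supersingular

variable {W : WeierstrassCurve ℚ}

/-- **Some period cusp value of `[·]⁺_f` has `2`-adic norm exactly `2`**: for a normalised newform with rational coefficients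
there is `γ ∈ Γ₀(N)` with `c(γ) ≠ 0` and `[γ∞]⁺_f = 1/2` (`re{∞, γ∞}_f = Ω⁺_f/2` for some `γ`, since `Ω⁺_f/2` generates `re Λ_f`;
`…CuspSpanHecke.exists_re_cuspSymbol_eq_plusPeriod_half`). [cite: CremonaAlgorithms1997, §2.8] -/
theorem exists_ratPlusSymbol_maninCusp_eq_one_half {N : ℕ} [NeZero N] (f : CuspForm (Gamma0 N) 2) (hf : IsNewform0 f)
    (hQ : coeffField f = ⊥) :
    ∃ γ : Gamma0 N, (γ : SL(2, ℤ)) 1 0 ≠ 0 ∧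
      ratPlusSymbol f ((((γ : SL(2, ℤ)) 0 0 : ℚ)) / (((γ : SL(2, ℤ)) 1 0 : ℚ))) = 1 / 2 := by
  have hΩ : plusPeriod f ≠ 0 := (IsNewform0.plusPeriod_pos_holds hf hQ).ne'
  obtain ⟨γ, hγ⟩ := SignedMuAtTwo.exists_re_cuspSymbol_eq_plusPeriod_half f hΩ
  have hc : (γ : SL(2, ℤ)) 1 0 ≠ 0 := by
    intro hc
    have h0 : cuspSymbol f γ = 0 := by unfold cuspSymbol; rw [if_pos hc]
    rw [h0, Complex.zero_re] at hγ
    exact hΩ (by linarith)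
  refine ⟨γ, hc, ?_⟩
  have hreal : ∀ n, (cuspCoeff f n).im = 0 := cuspCoeff_im_eq_zero_of_coeffField_eq_bot hQ
  have hcusp : cuspSymbol f γ = modularSymbol f ((((γ : SL(2, ℤ)) 0 0 : ℚ)) / (((γ : SL(2, ℤ)) 1 0 : ℚ))) := by
    unfold cuspSymbol; rw [if_neg hc]
  apply Rat.cast_injective (α := ℝ)
  push_cast
  rw [ratCast_ratPlusSymbol_holds hf hQ, normalizedPlusSymbol, plusSymbol_eq_re_holds f hreal, Complex.ofReal_re, ← hcusp, hγ]
  field_simp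

/-- **(PR₂) at `(W, f)` ⟹ FLAT at `(W, f)`** (crux Kμ⁺'s analytic stub, per curve): if the undepleted `2`-adic plus symbol of the
newform `f` of `W` is maximal at a `2`-power cusp of some EVEN layer, then `2 ∤ L⁻` for EVERY Pollack pair `(L⁺, L⁻)` of `f` at `2`:
the maximum is `≥ ‖[γ∞]⁺_f‖₂ = ‖1/2‖₂ = 2` (`exists_ratPlusSymbol_maninCusp_eq_one_half`), so an even-layer `[5^s/2^{n+2}]⁺_f` has
`|·|₂ ≥ 2`, and rtt-p4's door `SignedMuAtTwo.flatAtTwo_of_two_le_norm_ratPlusSymbol` applies.  Hence the per-curve statement (PR₂) is a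
COMMON node of Kan⁺ (via `…MuW1OfUndepleted`) and of Kμ⁺'s analytic half (via FLAT + Abbes–Ullmo), weaker than `CuspSpanEvenAtTwo N_W`
(which implies it, `undepletedMax_of_cuspSpanEvenAtTwo`).  BSD is not proved by this. [cite: Pollack2003, Conj. 6.3 and Prop. 6.18] -/
theorem flatAtTwo_of_undepletedMax [NeZero (W.conductorNorm ℤ)] {f : CuspForm (Gamma0 (W.conductorNorm ℤ)) 2}
    (hf : IsNewformOf W f)
    (hmax : ∃ n₁ : ℕ, Even n₁ ∧ ∃ s : ZMod (2 ^ n₁), ∀ r : ℚ, ‖algebraMap ℚ (PadicAlgCl 2) (ratPlusSymbol f r)‖ ≤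
      ‖algebraMap ℚ (PadicAlgCl 2) (ratPlusSymbol f ((((Literature.NumberTheory.EllipticCurves.cyclotomicGenerator 2 : ZMod (2 ^ (n₁ + 2))) ^ s.val).val : ℚ) / (2 : ℚ) ^ (n₁ + 2)))‖) :
    ∀ Lplus Lminus : IwasawaAlgebra 2, IsPollackPair f 2 Lplus Lminus → ¬ PowerSeries.C (2 : ℤ_[2]) ∣ Lminus := by
  obtain ⟨n₁, hn₁, s, hle⟩ := hmax
  obtain ⟨γ, -, hγ⟩ := exists_ratPlusSymbol_maninCusp_eq_one_half f hf.1 hf.coeffField_eq_bot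
  refine SignedMuAtTwo.flatAtTwo_of_two_le_norm_ratPlusSymbol hn₁ (s := s) ?_
  rw [← norm_algebraMap_rat_eq_norm_ratCast_padic]
  refine le_trans ?_ (hle ((((γ : SL(2, ℤ)) 0 0 : ℚ)) / (((γ : SL(2, ℤ)) 1 0 : ℚ))))
  rw [hγ, one_div, map_inv₀, map_ofNat, norm_inv, ResidualThetaLayer.norm_two_padicAlgCl, inv_inv]

end Flat

/-! ## A per-curve certificate for (PR₂): a `2`-adic UNIT L-value `[0]⁺_f = L(f,1)/Ω⁺_f` (layer `n₁ = 0`) -/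

section LayerZero

open scoped MatrixGroups
open CongruenceSubgroup

variable {W : WeierstrassCurve ℚ} [W.IsElliptic] [W.IsGloballyMinimal]

/-- **(PR₂) at layer `n₁ = 0` from a unit L-value.**  On the habitat⁺ (`GoodSS W 2`, `a₂(W) = 0`), if `[0]⁺_f = L(f,1)/Ω⁺_f` is a
`2`-adic UNIT then the undepleted plus symbol is maximal at the layer-`0` cusp `1/4 = γ⁰/2²`: the `T₂`-relation at `x = 1/2` reads
`[1/4]⁺ + [3/4]⁺ + [1]⁺ = a₂[1/2]⁺ = 0`, i.e. `[0]⁺_f = −2[1/4]⁺_f`, so `‖[1/4]⁺_f‖₂ = 2`, the universal bound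
(`norm_ratPlusSymbol_le_two`).  A BSD-flavoured per-curve certificate (Kurihara's unit-L-value case: by BSD, `L(W,1)/Ω` odd ⟺
`Ш[2] = 0` and odd Tamagawa numbers); no conjecture-grade input.  BSD is not proved by this.
[cite: MazurTateTeitelbaum1986Invent, §I.4 (4.2)] [cite: Kurihara2002, Thm. 0.1 (unit L-value hypothesis; shape)] -/
theorem undepletedMax_layerZero_of_norm_ratPlusSymbol_zero_eq_one [NeZero (W.conductorNorm ℤ)]
    {f : CuspForm (Gamma0 (W.conductorNorm ℤ)) 2} (hf : IsNewformOf W f)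
    (hss : Literature.NumberTheory.EllipticCurves.Rank1Residual.GoodSS W 2) (ha : W.frobeniusTrace 2 = 0)
    (h0 : ‖algebraMap ℚ (PadicAlgCl 2) (ratPlusSymbol f 0)‖ = 1) :
    ∃ n₁ : ℕ, Even n₁ ∧ ∃ s : ZMod (2 ^ n₁), ∀ r : ℚ, ‖algebraMap ℚ (PadicAlgCl 2) (ratPlusSymbol f r)‖ ≤
      ‖algebraMap ℚ (PadicAlgCl 2) (ratPlusSymbol f ((((Literature.NumberTheory.EllipticCurves.cyclotomicGenerator 2 : ZMod (2 ^ (n₁ + 2))) ^ s.val).val : ℚ) / (2 : ℚ) ^ (n₁ + 2)))‖ := by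
  have hf0 : IsNewform0 f := hf.1
  have hQ : coeffField f = ⊥ := hf.coeffField_eq_bot
  have hΩf : IsPlusPeriod f (plusPeriod f : ℂ) := isPlusPeriod_plusPeriod hf0 hQ
  have h2N : ¬ 2 ∣ W.conductorNorm ℤ := SignedMuAtTwo.not_two_dvd_conductorNorm_of_goodSS hss
  obtain ⟨ι, hι, hιa⟩ := exists_embedding_of_isNewformOf hf
  -- the `T₂`-relation at `x = 1/2`: `[1/4]⁺ + [3/4]⁺ + [1]⁺ = 0`
  have hT := heckeRel_embPlusSymbol ι hf0 hΩf Nat.prime_two (1 / 2 : ℚ)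
  simp only [hι, hιa, if_neg h2N, Nat.cast_ofNat, Fin.sum_univ_two, Fin.val_zero, Fin.val_one, Nat.cast_zero,
    Nat.cast_one] at hT
  have ha2 : ((W.LFunction 2 : ℤ) : PadicAlgCl 2) = 0 := by
    rw [W.LFunction_apply_prime_eq_frobeniusTrace 2 hss.1, ha, Int.cast_zero]
  rw [ha2, zero_mul, mul_inv_cancel₀ (two_ne_zero : (2 : PadicAlgCl 2) ≠ 0), one_mul] at hT
  have e1 : ((1 / 2 : ℚ) + 0) / 2 = 1 / 4 := by norm_num
  have e2 : ((1 / 2 : ℚ) + 1) / 2 = -(1 / 4) + ((1 : ℤ) : ℚ) := by norm_num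
  have e3 : (2 : ℚ) * (1 / 2) = 0 + ((1 : ℤ) : ℚ) := by norm_num
  rw [e1, e2, e3, ratPlusSymbol_add_intCast_eq, ratPlusSymbol_neg, ratPlusSymbol_add_intCast_eq] at hT
  -- `[0]⁺ = −2[1/4]⁺`, hence `‖[1/4]⁺‖ = 2`
  have hq : ‖algebraMap ℚ (PadicAlgCl 2) (ratPlusSymbol f (1 / 4))‖ = 2 := by
    have e : algebraMap ℚ (PadicAlgCl 2) (ratPlusSymbol f 0) = -(2 * algebraMap ℚ (PadicAlgCl 2) (ratPlusSymbol f (1 / 4))) := by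
      linear_combination hT.symm
    have hn := congrArg (fun z ↦ ‖z‖) e
    simp only [norm_neg, norm_mul, ResidualThetaLayer.norm_two_padicAlgCl, h0] at hn
    linarith
  haveI : Fact (1 < 2 ^ (0 + 2)) := ⟨by norm_num⟩
  refine ⟨0, ⟨0, rfl⟩, 0, fun r ↦ ?_⟩
  have hc : ((((Literature.NumberTheory.EllipticCurves.cyclotomicGenerator 2 : ZMod (2 ^ (0 + 2))) ^ (0 : ZMod (2 ^ 0)).val).val : ℚ) / (2 : ℚ) ^ (0 + 2)) = 1 / 4 := by
    rw [ZMod.val_zero, pow_zero, ZMod.val_one]; norm_num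
  rw [hc, hq]
  exact norm_ratPlusSymbol_le_two hf hss ha r

end LayerZero

end Summit.BirchSwinnertonDyer.BirchSwinnertonDyer.Theorems.ThetaLayerLambdaCongruenceAtTwo

end
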